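import Literature.Geometry.Kaehler.ComplexTorusHodgeDomainHodgeClassLocusCovariance
import Literature.Geometry.Kaehler.ComplexTorusHodgeDomainDivisorClassLoci
import HarnessLib

/-!
# Noether–Lefschetz loci of 1-cycle (curve) classes `δ ∈ H^{2g-2}(X, ℚ)` and of all Lefschetz-type classes `Lʲψ`, `ψ ∈ H²(X, ℚ)`,
# on a polarised complex torus are endomorphism loci (special loci of PEL type): `D_δ = D_ψ = D^{φ(ψ)}`; their `Γ`-translates are
# locally finite and their images in `Γ\D` are closed

Let `(X, E₀)` be a polarised complex torus of dimension `g`, `X = E/Φ(ℤ^ι)`, with Mumford–Tate domain `D = Hg(X)(ℝ) · F⁰`. In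
`ComplexTorusHodgeDomainDivisorClassLoci.lean` (g20-#4) the Noether–Lefschetz locus `D_ψ` of a rational DIVISOR class `ψ ∈ H²(X, ℚ)`
was identified with the endomorphism locus `D^{φ(ψ)}`, `φ(ψ) = G₀⁻¹ C_ψ` (Lange 2023, Prop. 2.4.12 (a) along `D`), whence the local
finiteness of its `Γ`-translates and the closedness of its image in `Γ\D` (Cattani–Deligne–Kaplan's theorem in the weight-two torus
case; Moonen–Oort: special subvarieties of PEL type). By the Lefschetz invariance of Noether–Lefschetz loci (g26-#1:
`D_{Lʲψ} = D_ψ` for `2 + j ≤ g`) all of this transfers to the LEFSCHETZ-TYPE classes `Lʲψ = E₀^{∧j} ∧ ψ` of every degree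
`2(j+1) ≤ 2g - 2`, and by hard Lefschetz over `ℚ` (g26-#3: every `δ ∈ H^{2(p+j)}(X, ℚ)`, `2p + j = g`, is `Lʲψ` for a unique
`ψ ∈ H^{2p}(X, ℚ)`, with `D_δ = D_ψ`) EVERY rational class of degree `2g - 2` — every 1-cycle (curve) class — is of this form with
`ψ` a divisor class: "the Hodge `(n-1,n-1)`-conjecture is true for any abelian variety" (Lange §7.3.3 Exercise (2) (b)) has the
Noether–Lefschetz counterpart `D_δ = D_ψ = D^{φ(ψ)}`. In particular on a polarised torus of dimension `3` every Noether–Lefschetz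
locus of a class (degrees `2` and `4`) is an endomorphism locus with closed image in `Γ\D`.

Layer `Literature/Geometry/Kaehler`, namespace `Literature.Geometry.Kaehler.ComplexTorus`; lane `lit-hodgefound` (Track 2 foundations
library), prover seat p40 (generation 26), row g26-#4. THEOREMS ONLY: no definition, no instance, no named fact, net debt 0. Sequel,
BY NAME (nothing restated), of g26-#1 `ComplexTorusHodgeDomainHodgeClassLocusLefschetz.lean` (`IsRiemannForm.hodgeDomainLocus_stabEqs_lefschetzPow`,
`IsRiemannForm.hodgeDomainLocus_stabEqs_lefschetzPow_eq_univ_iff`), g26-#3 `ComplexTorusHodgeDomainHodgeClassLocusCovariance.lean`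
(`IsRiemannForm.exists_lefschetzPow_eq_and_hodgeDomainLocus_stabEqs_eq`), g20-#4 `ComplexTorusHodgeDomainDivisorClassLoci.lean`
(`IsRiemannForm.hodgeDomainLocus_stabEqs_eq_hodgeDomainLocus_centralizerEqs(_of_ratCoord)`,
`IsRiemannForm.exists_hodgeDomainLocus_stabEqs_eq_hodgeDomainLocus_centralizerEqs`,
`IsRiemannForm.hodgeDomainLocus_stabEqs_eq_univ_iff_inv_mul_mem_endAlgRat`, `IsRiemannForm.locallyFinite_orbit_hodgeDomainLocus_stabEqs(_of_le)`,
`IsRiemannForm.finite_setOf_orbit_hodgeDomainLocus_stabEqs_inter_nonempty/_mem`, `IsRiemannForm.isClosed_iUnion_smul_set_hodgeDomainLocus_stabEqs`,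
`IsRiemannForm.isClosed_image_mk_hodgeDomainLocus_stabEqs`, `…_hodgeGroupInt_…`, `…_hodgeGroupCong_…`,
`IsRiemannForm.isClosed_heckeImage_image_mk_hodgeDomainLocus_stabEqs`), of `ComplexTorusLefschetzDecomposition.lean` (`lefschetzPow`),
`ComplexTorusHodgeGroup.lean` (`centralizerEqs A`: the equations of the commutant of `A`; `stabEqs`, `ratCoord`), `ComplexTorusRosati.lean`
(`IsRiemannForm.exists_ratMatrix_latticeGram`), `ComplexTorusPolarizationType.lean` (`latticeGram`), `ComplexTorusHodgeClasses.lean` (`reForm`,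
`rationalForms`), `ComplexTorusHodgeDomainArithmeticQuotient.lean` (`hodgeGroupInt = Hg(X)(ℤ)`, `hodgeGroupCong`),
`ComplexTorusHodgeGroupRationalCommensurator.lean` (`hodgeGroupRat`, `Subgroup.Commensurable`), `ComplexTorusHodgeDomainHeckeCorrespondences.lean`
(`heckeImage`), `ComplexTorusHodgeDomainHodgeLoci.lean` (`hodgeDomainLocus`).

## The dictionary

`D_γ = hodgeDomainLocus Φ (stabEqs (ratCoord Φ hγ))` is the Noether–Lefschetz locus of the rational class `γ` (g18-#4);
`D^A = hodgeDomainLocus Φ (centralizerEqs A)` is the locus where the rational matrix `A ∈ End(H₁(X, ℚ))` is an endomorphism of `X_x`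
(g18-#1 / g20-#3); `G₀` is the rational Gram matrix of the polarisation `E₀ = η` on the lattice, `C_ψ = (ψ(λᵢ, λⱼ))` that of the
divisor class `ψ`, and `φ(ψ) = G₀⁻¹ C_ψ` is Lange's `φ_{L₀}⁻¹ φ_ψ ∈ End_ℚ` (Prop. 2.4.12 / 5.2.1). A "curve class" is a rational class of
degree `2q` with `q + 1 = g` (`H^{2g-2}(X, ℚ) ≅ H₂(X, ℚ)` by Poincaré duality); subtraction-free bookkeeping: `j + 1 = q`,
`q + 1 = g = finrank ℂ E`.

## Sources, verbatim

* H. Lange, *Abelian Varieties over the Complex Numbers* (2023), §7.3.3 Exercise (2) (p. 341): "(b) The Hodge `(n-1, n-1)`-conjecture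
  is true for any abelian variety of dimension `n`. […] (Hint: […] For (b) use property (1) for the Lefschetz operator in Section
  7.3.2.)"; §7.3.2 (1) (p. 338): "`L^{g-k} : ⋀ᵏ V → ⋀^{2g-k} V` is an isomorphism of `Sp(V, E)`-representations, for `k = 0, …, g`";
  §2.4.2 Prop. 2.4.12 (a) (`NS_ℚ(X) ≅` the symmetric elements of `End_ℚ(X)` via `φ_{L₀}⁻¹ φ_L`).
* P. Deligne, *Hodge cycles on abelian varieties* (1982), I §2, 2.1 (c): "The class `x` is an absolute Hodge cycle if and only if
  `γ^{d-2p} · x` is an absolute Hodge cycle."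
* E. Cattani, P. Deligne, A. Kaplan, *On the locus of Hodge classes*, J. AMS 8 (1995), §1 (p. 483): "locally on `S`, `S^{(K)}` is a
  finite disjoint sum of closed analytic subspaces"; Thm. 1.1 ("finite over `S`").
* B. Moonen, F. Oort, *The Torelli locus and special subvarieties* (2013), §"Hodge loci" (arXiv v1 p. 9): "The image of this locus
  in `S` is a countable union of closed irreducible analytic subspaces"; §"Special subvarieties" Example 11 / Remark 12: "the closed
  subvarieties `Z ⊂ 𝒜_{g,[m],ℂ}` 'defined by' the existence of endomorphisms […] special subvarieties of PEL type"; §3 (a): "Hecke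
  images of special subvarieties are again special."
* M. Green, P. Griffiths, M. Kerr, *Mumford–Tate Groups and Domains* (2012), §II.C (p. 59): "the Noether-Lefschetz-locus is the
  subvariety `S_ζ ⊂ S` where `ζ` remains a Hodge class", Remark (p. 61).

## What is proved (polarised complex torus `(X, η)`, `hη : IsRiemannForm Φ η`; `Γ` commensurable with `Hg(X)(ℤ)` where stated)

* §1 LEFSCHETZ-TYPE CLASSES `Lʲψ`, `ψ ∈ H²(X, ℚ)`, `2 + j ≤ g`:
  **`IsRiemannForm.hodgeDomainLocus_stabEqs_lefschetzPow_eq_centralizerEqs`** (`D_{Lʲψ} = D^{G₀⁻¹ C}`), `…_of_ratCoord`,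
  `IsRiemannForm.exists_hodgeDomainLocus_stabEqs_lefschetzPow_eq_centralizerEqs` (`∃ A, D_{Lʲψ} = D^A`),
  `IsRiemannForm.hodgeDomainLocus_stabEqs_lefschetzPow_eq_univ_iff_inv_mul_mem_endAlgRat` (`D_{Lʲψ} = D ⟺ φ(ψ) ∈ End_ℚ(X)`),
  `IsRiemannForm.locallyFinite_orbit_hodgeDomainLocus_stabEqs_lefschetzPow`, **`IsRiemannForm.isClosed_image_mk_hodgeDomainLocus_stabEqs_lefschetzPow`**,
  `IsRiemannForm.isClosed_iUnion_smul_set_hodgeDomainLocus_stabEqs_lefschetzPow`.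
* §2 CURVE CLASSES `δ ∈ H^{2q}(X, ℚ)`, `q + 1 = g ≥ 2`: ★ **`IsRiemannForm.exists_divisorClass_hodgeDomainLocus_stabEqs_eq`** (a unique
  `ψ ∈ H²(X, ℚ)` with `η^{∧(g-2)} ∧ ψ = δ`, and `D_δ = D_ψ`), ★ **`IsRiemannForm.exists_hodgeDomainLocus_stabEqs_eq_centralizerEqs_of_curveClass`**
  (`∃ A ∈ M_ι(ℚ)`, `D_δ = D^A`: PEL type), **`IsRiemannForm.locallyFinite_orbit_hodgeDomainLocus_stabEqs_of_curveClass`**,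
  `IsRiemannForm.finite_setOf_orbit_hodgeDomainLocus_stabEqs_inter_nonempty_of_curveClass`, `…_mem_of_curveClass`,
  `IsRiemannForm.isClosed_iUnion_smul_set_hodgeDomainLocus_stabEqs_of_curveClass`, ★★ **`IsRiemannForm.isClosed_image_mk_hodgeDomainLocus_stabEqs_of_curveClass`**
  (THE IMAGE IN `Γ\D` OF THE NOETHER–LEFSCHETZ LOCUS OF A CURVE CLASS IS CLOSED), `…_hodgeGroupInt_…`, `…_hodgeGroupCong_…`,
  `IsRiemannForm.isClosed_heckeImage_image_mk_hodgeDomainLocus_stabEqs_of_curveClass`, `IsAbelianVariety.isClosed_image_mk_hodgeDomainLocus_stabEqs_of_curveClass`.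
* §3 DIMENSION THREE: `IsRiemannForm.exists_hodgeDomainLocus_stabEqs_eq_centralizerEqs_of_finrank_eq_three` and
  `IsRiemannForm.isClosed_image_mk_hodgeDomainLocus_stabEqs_of_finrank_eq_three` (every class of degree `4` on a polarised torus of
  dimension `3`).

NOT here: classes of intermediate degree `4 ≤ 2k ≤ 2g - 4` that are not of Lefschetz type (their loci are `D_{γ₀} ∩ D_β`, g26-#2,
with `γ₀` primitive — no PEL description is claimed for `D_{γ₀}`), algebraicity of the images (Cattani–Deligne–Kaplan's full
theorem), irreducible components. The Hodge conjecture is not addressed.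

## References

* [Lange2023AbelianVarietiesComplex] H. Lange, *Abelian Varieties over the Complex Numbers* (2023) — §2.4.2 Prop. 2.4.12 (a); §7.3.2
  (1) (p. 338); §7.3.3 Exercise (2) (b) (p. 341).
* [Deligne1982HodgeCycles] P. Deligne, *Hodge cycles on abelian varieties*, LNM 900 (1982) — I §2, 2.1 (c).
* [CattaniDeligneKaplan1995] E. Cattani, P. Deligne, A. Kaplan, *On the locus of Hodge classes*, J. AMS 8 (1995) — §1 (p. 483),
  Thm. 1.1.
* [MoonenOort2013Torelli] B. Moonen, F. Oort, *The Torelli locus and special subvarieties*, Handbook of Moduli II (2013) — §"Hodge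
  loci" (p. 9), §"Special subvarieties" Example 11 / Remark 12, §3 (a).
* [GreenGriffithsKerr2012] M. Green, P. Griffiths, M. Kerr, *Mumford–Tate Groups and Domains* (2012) — §II.C (p. 59, Remark p. 61).
-/

noncomputable section

open scoped Matrix ComplexOrder Topology Manifold Pointwise Real
open Set Function Module Matrix Filter Complex
open _root_.Topology

namespace Literature.Geometry.Kaehler

namespace ComplexTorus

variable {ι : Type*} [Fintype ι] [DecidableEq ι] {E : Type*} [NormedAddCommGroup E] [NormedSpace ℂ E]
  {Φ : (ι → ℝ) ≃L[ℝ] E}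

/-! ## §1 Lefschetz-type classes `Lʲψ`, `ψ` a rational divisor class -/

section LefschetzType

variable {η : E [⋀^Fin 2]→L[ℝ] ℝ} {G₀ C : Matrix ι ι ℚ} {ψ : E [⋀^Fin 2]→L[ℝ] ℂ} {Γ : Subgroup (hodgeGroup Φ)}

/-- **`D_{Lʲψ} = D^{G₀⁻¹ C}`: the Noether–Lefschetz locus of the Lefschetz-type class `η^{∧j} ∧ ψ` (`ψ ∈ H²(X, ℚ)`, `2 + j ≤ g`) of a
polarised torus is the endomorphism locus of `φ(ψ) = G₀⁻¹ C_ψ`** (`D_{Lʲψ} = D_ψ` by Lefschetz invariance, and `D_ψ = D^{φ(ψ)}` by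
Prop. 2.4.12 along `D`). [cite: Deligne1982HodgeCycles, I §2, 2.1 (c)] [cite: Lange2023AbelianVarietiesComplex, §2.4.2 Prop. 2.4.12 (a) and §7.3.2 (1)] [cite: MoonenOort2013Torelli, §"Special subvarieties" Example 11 / Remark 12] -/
theorem IsRiemannForm.hodgeDomainLocus_stabEqs_lefschetzPow_eq_centralizerEqs (hη : IsRiemannForm Φ η)
    (hG₀ : G₀.map (Rat.cast : ℚ → ℝ) = latticeGram Φ η) (hψ : ψ ∈ rationalForms Φ 2)
    (hC : C.map (Rat.cast : ℚ → ℝ) = latticeGram Φ (reForm ψ)) {j q : ℕ} (h : 2 * j + 2 = 2 * q)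
    (hj : 2 + j ≤ finrank ℂ E) (hLψ : lefschetzPow η j h ψ ∈ rationalForms Φ (2 * q)) :
    hodgeDomainLocus Φ (stabEqs (ratCoord Φ hLψ)) = hodgeDomainLocus Φ (centralizerEqs (G₀⁻¹ * C)) :=
  (hη.hodgeDomainLocus_stabEqs_lefschetzPow (p := 1) h hj hψ hLψ).trans
    (hη.hodgeDomainLocus_stabEqs_eq_hodgeDomainLocus_centralizerEqs hG₀ hψ hC)

/-- The same with the explicit coordinate matrix `C_ψ = (ψ(λᵢ, λⱼ))`: `D_{Lʲψ} = D^{G₀⁻¹ C_ψ}`.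
[cite: Lange2023AbelianVarietiesComplex, §2.4.2 Prop. 2.4.12 (a) and §7.3.2 (1)] [cite: GreenGriffithsKerr2012, §II.C Remark (p. 61)] -/
theorem IsRiemannForm.hodgeDomainLocus_stabEqs_lefschetzPow_eq_centralizerEqs_of_ratCoord (hη : IsRiemannForm Φ η)
    (hG₀ : G₀.map (Rat.cast : ℚ → ℝ) = latticeGram Φ η) (hψ : ψ ∈ rationalForms Φ 2) {j q : ℕ} (h : 2 * j + 2 = 2 * q)
    (hj : 2 + j ≤ finrank ℂ E) (hLψ : lefschetzPow η j h ψ ∈ rationalForms Φ (2 * q)) :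
    hodgeDomainLocus Φ (stabEqs (ratCoord Φ hLψ)) =
      hodgeDomainLocus Φ (centralizerEqs (G₀⁻¹ * Matrix.of fun i k ↦ ratCoord Φ hψ ![i, k])) :=
  (hη.hodgeDomainLocus_stabEqs_lefschetzPow (p := 1) h hj hψ hLψ).trans
    (hη.hodgeDomainLocus_stabEqs_eq_hodgeDomainLocus_centralizerEqs_of_ratCoord hG₀ hψ)

/-- **Every `D_{Lʲψ}` is SOME endomorphism locus `D^A`, `A ∈ M_ι(ℚ)`** (a special locus of PEL type).
[cite: MoonenOort2013Torelli, §"Special subvarieties" Example 11 / Remark 12] [cite: Lange2023AbelianVarietiesComplex, §2.4.2 Prop. 2.4.12 (a)] -/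
theorem IsRiemannForm.exists_hodgeDomainLocus_stabEqs_lefschetzPow_eq_centralizerEqs (hη : IsRiemannForm Φ η)
    (hψ : ψ ∈ rationalForms Φ 2) {j q : ℕ} (h : 2 * j + 2 = 2 * q) (hj : 2 + j ≤ finrank ℂ E)
    (hLψ : lefschetzPow η j h ψ ∈ rationalForms Φ (2 * q)) :
    ∃ A : Matrix ι ι ℚ, hodgeDomainLocus Φ (stabEqs (ratCoord Φ hLψ)) = hodgeDomainLocus Φ (centralizerEqs A) := by
  rw [hη.hodgeDomainLocus_stabEqs_lefschetzPow (p := 1) h hj hψ hLψ]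
  exact hη.exists_hodgeDomainLocus_stabEqs_eq_hodgeDomainLocus_centralizerEqs hψ

/-- **`D_{Lʲψ} = D ⟺ G₀⁻¹ C_ψ ∈ End_ℚ(X)`**: the Lefschetz-type class is a Hodge class everywhere iff `φ(ψ)` is an endomorphism of
`X` (iff `ψ` is a divisor class of `X`). [cite: Lange2023AbelianVarietiesComplex, §2.4.2 Prop. 2.4.12 (a) and §7.3.2 (1)] [cite: Deligne1982HodgeCycles, I §2, 2.1 (c)] -/
theorem IsRiemannForm.hodgeDomainLocus_stabEqs_lefschetzPow_eq_univ_iff_inv_mul_mem_endAlgRat (hη : IsRiemannForm Φ η)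
    (hG₀ : G₀.map (Rat.cast : ℚ → ℝ) = latticeGram Φ η) (hψ : ψ ∈ rationalForms Φ 2)
    (hC : C.map (Rat.cast : ℚ → ℝ) = latticeGram Φ (reForm ψ)) {j q : ℕ} (h : 2 * j + 2 = 2 * q)
    (hj : 2 + j ≤ finrank ℂ E) (hLψ : lefschetzPow η j h ψ ∈ rationalForms Φ (2 * q)) :
    hodgeDomainLocus Φ (stabEqs (ratCoord Φ hLψ)) = univ ↔ G₀⁻¹ * C ∈ endAlgRat Φ := by
  rw [hη.hodgeDomainLocus_stabEqs_lefschetzPow (p := 1) h hj hψ hLψ]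
  exact hη.hodgeDomainLocus_stabEqs_eq_univ_iff_inv_mul_mem_endAlgRat hG₀ hψ hC

/-- **The `Γ`-translates of `D_{Lʲψ}` form a locally finite family** (`Γ` commensurable with `Hg(X)(ℤ)`).
[cite: CattaniDeligneKaplan1995, §1 (p. 483: "locally on `S`, `S^{(K)}` is a finite disjoint sum of closed analytic subspaces")] [cite: Deligne1982HodgeCycles, I §2, 2.1 (c)] -/
theorem IsRiemannForm.locallyFinite_orbit_hodgeDomainLocus_stabEqs_lefschetzPow (hη : IsRiemannForm Φ η)
    (hΓ : Γ.Commensurable (hodgeGroupInt Φ)) (hψ : ψ ∈ rationalForms Φ 2) {j q : ℕ} (h : 2 * j + 2 = 2 * q)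
    (hj : 2 + j ≤ finrank ℂ E) (hLψ : lefschetzPow η j h ψ ∈ rationalForms Φ (2 * q)) :
    LocallyFinite (fun T : MulAction.orbit Γ (hodgeDomainLocus Φ (stabEqs (ratCoord Φ hLψ))) ↦ (T : Set (hodgeDomainOpens Φ))) := by
  rw [hη.hodgeDomainLocus_stabEqs_lefschetzPow (p := 1) h hj hψ hLψ]
  exact hη.locallyFinite_orbit_hodgeDomainLocus_stabEqs hΓ hψ

/-- **`Γ · D_{Lʲψ}` is closed in `D`** (`Γ` arithmetic). [cite: CattaniDeligneKaplan1995, §1 (p. 483)] [cite: MoonenOort2013Torelli, §"Hodge loci" (arXiv v1 p. 9)] -/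
theorem IsRiemannForm.isClosed_iUnion_smul_set_hodgeDomainLocus_stabEqs_lefschetzPow (hη : IsRiemannForm Φ η)
    (hΓ : Γ.Commensurable (hodgeGroupInt Φ)) (hψ : ψ ∈ rationalForms Φ 2) {j q : ℕ} (h : 2 * j + 2 = 2 * q)
    (hj : 2 + j ≤ finrank ℂ E) (hLψ : lefschetzPow η j h ψ ∈ rationalForms Φ (2 * q)) :
    IsClosed (⋃ g : Γ, (g : hodgeGroup Φ) • hodgeDomainLocus Φ (stabEqs (ratCoord Φ hLψ))) := by
  rw [hη.hodgeDomainLocus_stabEqs_lefschetzPow (p := 1) h hj hψ hLψ]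
  exact hη.isClosed_iUnion_smul_set_hodgeDomainLocus_stabEqs hΓ hψ

/-- **The image in `Γ\D` of the Noether–Lefschetz locus of a Lefschetz-type class `Lʲψ` is closed** (`Γ` commensurable with
`Hg(X)(ℤ)`). [cite: CattaniDeligneKaplan1995, §1 (p. 483), Thm. 1.1] [cite: MoonenOort2013Torelli, §"Special subvarieties" Example 11 / Remark 12] [cite: Deligne1982HodgeCycles, I §2, 2.1 (c)] -/
theorem IsRiemannForm.isClosed_image_mk_hodgeDomainLocus_stabEqs_lefschetzPow (hη : IsRiemannForm Φ η)
    (hΓ : Γ.Commensurable (hodgeGroupInt Φ)) (hψ : ψ ∈ rationalForms Φ 2) {j q : ℕ} (h : 2 * j + 2 = 2 * q)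
    (hj : 2 + j ≤ finrank ℂ E) (hLψ : lefschetzPow η j h ψ ∈ rationalForms Φ (2 * q)) :
    IsClosed (Quotient.mk (MulAction.orbitRel Γ (hodgeDomainOpens Φ)) '' hodgeDomainLocus Φ (stabEqs (ratCoord Φ hLψ))) := by
  rw [hη.hodgeDomainLocus_stabEqs_lefschetzPow (p := 1) h hj hψ hLψ]
  exact hη.isClosed_image_mk_hodgeDomainLocus_stabEqs hΓ hψ

end LefschetzType

/-! ## §2 Curve classes: every `δ ∈ H^{2g-2}(X, ℚ)` is `L^{g-2}ψ` for a unique divisor class `ψ`, and `D_δ = D_ψ = D^{φ(ψ)}` -/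

section CurveClass

variable {η : E [⋀^Fin 2]→L[ℝ] ℝ} {Γ : Subgroup (hodgeGroup Φ)} {j q : ℕ} {δ : E [⋀^Fin (2 * q)]→L[ℝ] ℂ}

/-- ★ **THE NOETHER–LEFSCHETZ LOCUS OF A CURVE CLASS IS THE NOETHER–LEFSCHETZ LOCUS OF A DIVISOR CLASS**: on a polarised torus of
dimension `g = q + 1 ≥ 2` every rational class `δ ∈ H^{2q}(X, ℚ) = H^{2g-2}(X, ℚ)` is `δ = η^{∧(g-2)} ∧ ψ` for a UNIQUE
`ψ ∈ H²(X, ℚ)`, and `D_δ = D_ψ` (hard Lefschetz over `ℚ`, "`x` is a Hodge cycle iff `γ^{d-2p} · x` is"; the torus case of "the Hodge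
`(n-1,n-1)`-conjecture is true for any abelian variety", read along the whole Mumford–Tate domain).
[cite: Lange2023AbelianVarietiesComplex, §7.3.3 Exercise (2) (b) (p. 341) and §7.3.2 (1) (p. 338)] [cite: Deligne1982HodgeCycles, I §2, 2.1 (c)] [cite: GreenGriffithsKerr2012, §II.C (p. 59), Remark (p. 61)] -/
theorem IsRiemannForm.exists_divisorClass_hodgeDomainLocus_stabEqs_eq (hη : IsRiemannForm Φ η) (hjq : j + 1 = q)
    (hg : q + 1 = finrank ℂ E) (hδ : δ ∈ rationalForms Φ (2 * q)) :
    ∃ (ψ : E [⋀^Fin 2]→L[ℝ] ℂ) (hψ : ψ ∈ rationalForms Φ 2),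
      lefschetzPow η j (show 2 * j + 2 = 2 * q by omega) ψ = δ ∧
        (∀ ψ' : E [⋀^Fin 2]→L[ℝ] ℂ, lefschetzPow η j (show 2 * j + 2 = 2 * q by omega) ψ' = δ → ψ' = ψ) ∧
          hodgeDomainLocus Φ (stabEqs (ratCoord Φ hδ)) = hodgeDomainLocus Φ (stabEqs (ratCoord Φ hψ)) :=
  hη.exists_lefschetzPow_eq_and_hodgeDomainLocus_stabEqs_eq (p := 1) (j := j) (q := q) (by omega) (by omega) hδ

/-- ★ **NOETHER–LEFSCHETZ LOCI OF CURVE CLASSES ARE ENDOMORPHISM LOCI (SPECIAL LOCI OF PEL TYPE)**: for every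
`δ ∈ H^{2g-2}(X, ℚ)` on a polarised torus of dimension `g ≥ 2` there is a rational matrix `A` (namely `φ(ψ) = G₀⁻¹ C_ψ` for the
divisor class `ψ` with `L^{g-2}ψ = δ`) with `D_δ = D^A`. [cite: Lange2023AbelianVarietiesComplex, §2.4.2 Prop. 2.4.12 (a), §7.3.3 Exercise (2) (b)] [cite: MoonenOort2013Torelli, §"Special subvarieties" Example 11 / Remark 12] [cite: Deligne1982HodgeCycles, I §2, 2.1 (c)] -/
theorem IsRiemannForm.exists_hodgeDomainLocus_stabEqs_eq_centralizerEqs_of_curveClass (hη : IsRiemannForm Φ η)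
    (hjq : j + 1 = q) (hg : q + 1 = finrank ℂ E) (hδ : δ ∈ rationalForms Φ (2 * q)) :
    ∃ A : Matrix ι ι ℚ, hodgeDomainLocus Φ (stabEqs (ratCoord Φ hδ)) = hodgeDomainLocus Φ (centralizerEqs A) := by
  obtain ⟨ψ, hψ, -, -, hD⟩ := hη.exists_divisorClass_hodgeDomainLocus_stabEqs_eq hjq hg hδ
  rw [hD]
  exact hη.exists_hodgeDomainLocus_stabEqs_eq_hodgeDomainLocus_centralizerEqs hψ

/-- **The `Γ`-translates of the Noether–Lefschetz locus of a curve class form a locally finite family** (`Γ` commensurable with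
`Hg(X)(ℤ)`; only finitely many classes of the `Γ`-orbit of `δ` become Hodge on a given compact set, up to stabilisers).
[cite: CattaniDeligneKaplan1995, §1 (p. 483: "locally on `S`, `S^{(K)}` is a finite disjoint sum of closed analytic subspaces")] [cite: Lange2023AbelianVarietiesComplex, §7.3.3 Exercise (2) (b)] -/
theorem IsRiemannForm.locallyFinite_orbit_hodgeDomainLocus_stabEqs_of_curveClass (hη : IsRiemannForm Φ η)
    (hΓ : Γ.Commensurable (hodgeGroupInt Φ)) (hjq : j + 1 = q) (hg : q + 1 = finrank ℂ E) (hδ : δ ∈ rationalForms Φ (2 * q)) :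
    LocallyFinite (fun T : MulAction.orbit Γ (hodgeDomainLocus Φ (stabEqs (ratCoord Φ hδ))) ↦ (T : Set (hodgeDomainOpens Φ))) := by
  obtain ⟨ψ, hψ, -, -, hD⟩ := hη.exists_divisorClass_hodgeDomainLocus_stabEqs_eq hjq hg hδ
  rw [hD]
  exact hη.locallyFinite_orbit_hodgeDomainLocus_stabEqs hΓ hψ

/-- The same for a subgroup `Γ ≤ Hg(X)(ℤ)`. [cite: CattaniDeligneKaplan1995, §1 (p. 483)] -/
theorem IsRiemannForm.locallyFinite_orbit_hodgeDomainLocus_stabEqs_of_curveClass_of_le (hη : IsRiemannForm Φ η)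
    (hΓ : Γ ≤ hodgeGroupInt Φ) (hjq : j + 1 = q) (hg : q + 1 = finrank ℂ E) (hδ : δ ∈ rationalForms Φ (2 * q)) :
    LocallyFinite (fun T : MulAction.orbit Γ (hodgeDomainLocus Φ (stabEqs (ratCoord Φ hδ))) ↦ (T : Set (hodgeDomainOpens Φ))) := by
  obtain ⟨ψ, hψ, -, -, hD⟩ := hη.exists_divisorClass_hodgeDomainLocus_stabEqs_eq hjq hg hδ
  rw [hD]
  exact hη.locallyFinite_orbit_hodgeDomainLocus_stabEqs_of_le hΓ hψ

/-- Arithmetic `Γ`: **only finitely many `Γ`-translates of the locus of a curve class meet a given compact set.**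
[cite: CattaniDeligneKaplan1995, §1 (p. 483)] [cite: CarlsonMullerStachPeters2017, §4.5 (p. 143)] -/
theorem IsRiemannForm.finite_setOf_orbit_hodgeDomainLocus_stabEqs_inter_nonempty_of_curveClass (hη : IsRiemannForm Φ η)
    (hΓ : Γ.Commensurable (hodgeGroupInt Φ)) (hjq : j + 1 = q) (hg : q + 1 = finrank ℂ E) (hδ : δ ∈ rationalForms Φ (2 * q))
    {K : Set (hodgeDomainOpens Φ)} (hK : IsCompact K) :
    {T : Set (hodgeDomainOpens Φ) |
      T ∈ MulAction.orbit Γ (hodgeDomainLocus Φ (stabEqs (ratCoord Φ hδ))) ∧ (T ∩ K).Nonempty}.Finite := by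
  obtain ⟨ψ, hψ, -, -, hD⟩ := hη.exists_divisorClass_hodgeDomainLocus_stabEqs_eq hjq hg hδ
  rw [hD]
  exact hη.finite_setOf_orbit_hodgeDomainLocus_stabEqs_inter_nonempty hΓ hψ hK

/-- Arithmetic `Γ`: a point of `D` lies on only finitely many `Γ`-translates of the locus of a curve class.
[cite: CattaniDeligneKaplan1995, §1 (p. 483)] [cite: CarlsonMullerStachPeters2017, §17.1 Def. 17.1.6 (p. 407)] -/
theorem IsRiemannForm.finite_setOf_orbit_hodgeDomainLocus_stabEqs_mem_of_curveClass (hη : IsRiemannForm Φ η)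
    (hΓ : Γ.Commensurable (hodgeGroupInt Φ)) (hjq : j + 1 = q) (hg : q + 1 = finrank ℂ E) (hδ : δ ∈ rationalForms Φ (2 * q))
    (x : hodgeDomainOpens Φ) :
    {T : Set (hodgeDomainOpens Φ) | T ∈ MulAction.orbit Γ (hodgeDomainLocus Φ (stabEqs (ratCoord Φ hδ))) ∧ x ∈ T}.Finite := by
  obtain ⟨ψ, hψ, -, -, hD⟩ := hη.exists_divisorClass_hodgeDomainLocus_stabEqs_eq hjq hg hδ
  rw [hD]
  exact hη.finite_setOf_orbit_hodgeDomainLocus_stabEqs_mem hΓ hψ x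

/-- **`Γ · D_δ` is closed in `D`** for a curve class `δ` (`Γ` arithmetic). [cite: CattaniDeligneKaplan1995, §1 (p. 483)] [cite: MoonenOort2013Torelli, §"Hodge loci" (arXiv v1 p. 9)] -/
theorem IsRiemannForm.isClosed_iUnion_smul_set_hodgeDomainLocus_stabEqs_of_curveClass (hη : IsRiemannForm Φ η)
    (hΓ : Γ.Commensurable (hodgeGroupInt Φ)) (hjq : j + 1 = q) (hg : q + 1 = finrank ℂ E) (hδ : δ ∈ rationalForms Φ (2 * q)) :
    IsClosed (⋃ g : Γ, (g : hodgeGroup Φ) • hodgeDomainLocus Φ (stabEqs (ratCoord Φ hδ))) := by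
  obtain ⟨ψ, hψ, -, -, hD⟩ := hη.exists_divisorClass_hodgeDomainLocus_stabEqs_eq hjq hg hδ
  rw [hD]
  exact hη.isClosed_iUnion_smul_set_hodgeDomainLocus_stabEqs hΓ hψ

/-- ★★ **THE IMAGE IN `Γ\D` OF THE NOETHER–LEFSCHETZ LOCUS OF A CURVE CLASS `δ ∈ H^{2g-2}(X, ℚ)` IS CLOSED** (`Γ` commensurable with
`Hg(X)(ℤ)`, `(X, η)` a polarised torus of dimension `g ≥ 2`): it is the image of the PEL-type locus `D^{φ(ψ)}` of the divisor class
`ψ` Lefschetz-dual to `δ`. [cite: CattaniDeligneKaplan1995, §1 (p. 483), Thm. 1.1] [cite: MoonenOort2013Torelli, §"Hodge loci" (arXiv v1 p. 9: "a countable union of closed irreducible analytic subspaces"), §"Special subvarieties" Example 11 / Remark 12] [cite: Lange2023AbelianVarietiesComplex, §7.3.3 Exercise (2) (b)] -/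
theorem IsRiemannForm.isClosed_image_mk_hodgeDomainLocus_stabEqs_of_curveClass (hη : IsRiemannForm Φ η)
    (hΓ : Γ.Commensurable (hodgeGroupInt Φ)) (hjq : j + 1 = q) (hg : q + 1 = finrank ℂ E) (hδ : δ ∈ rationalForms Φ (2 * q)) :
    IsClosed (Quotient.mk (MulAction.orbitRel Γ (hodgeDomainOpens Φ)) '' hodgeDomainLocus Φ (stabEqs (ratCoord Φ hδ))) := by
  obtain ⟨ψ, hψ, -, -, hD⟩ := hη.exists_divisorClass_hodgeDomainLocus_stabEqs_eq hjq hg hδ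
  rw [hD]
  exact hη.isClosed_image_mk_hodgeDomainLocus_stabEqs hΓ hψ

/-- The image of the locus of a curve class in `Hg(X)(ℤ)\D` is closed. [cite: CattaniDeligneKaplan1995, §1 (p. 483)] [cite: CarlsonMullerStachPeters2017, §17.1 Def. 17.1.6 (p. 407)] -/
theorem IsRiemannForm.isClosed_image_mk_hodgeGroupInt_hodgeDomainLocus_stabEqs_of_curveClass (hη : IsRiemannForm Φ η)
    (hjq : j + 1 = q) (hg : q + 1 = finrank ℂ E) (hδ : δ ∈ rationalForms Φ (2 * q)) :
    IsClosed (Quotient.mk (MulAction.orbitRel (hodgeGroupInt Φ) (hodgeDomainOpens Φ)) ''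
      hodgeDomainLocus Φ (stabEqs (ratCoord Φ hδ))) := by
  obtain ⟨ψ, hψ, -, -, hD⟩ := hη.exists_divisorClass_hodgeDomainLocus_stabEqs_eq hjq hg hδ
  rw [hD]
  exact hη.isClosed_image_mk_hodgeGroupInt_hodgeDomainLocus_stabEqs hψ

/-- The image of the locus of a curve class in every level quotient `Γ(n)\D` is closed. [cite: MoonenOort2013Torelli, §"Special subvarieties" Example 11 (`𝒜_{g,[m]}`)] [cite: CattaniDeligneKaplan1995, §1 (p. 483)] -/
theorem IsRiemannForm.isClosed_image_mk_hodgeGroupCong_hodgeDomainLocus_stabEqs_of_curveClass (hη : IsRiemannForm Φ η) (n : ℕ)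
    (hjq : j + 1 = q) (hg : q + 1 = finrank ℂ E) (hδ : δ ∈ rationalForms Φ (2 * q)) :
    IsClosed (Quotient.mk (MulAction.orbitRel (hodgeGroupCong Φ n) (hodgeDomainOpens Φ)) ''
      hodgeDomainLocus Φ (stabEqs (ratCoord Φ hδ))) := by
  obtain ⟨ψ, hψ, -, -, hD⟩ := hη.exists_divisorClass_hodgeDomainLocus_stabEqs_eq hjq hg hδ
  rw [hD]
  exact hη.isClosed_image_mk_hodgeGroupCong_hodgeDomainLocus_stabEqs n hψ

/-- Hecke images of the closed image of the locus of a curve class are closed (`q ∈ Hg(X)(ℚ)`). [cite: MoonenOort2013Torelli, §3 (a) ("Hecke images of special subvarieties are again special")] [cite: CattaniDeligneKaplan1995, §1 (p. 483)] -/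
theorem IsRiemannForm.isClosed_heckeImage_image_mk_hodgeDomainLocus_stabEqs_of_curveClass (hη : IsRiemannForm Φ η)
    (hΓ : Γ.Commensurable (hodgeGroupInt Φ)) {g : hodgeGroup Φ} (hgr : g ∈ hodgeGroupRat Φ) (hjq : j + 1 = q)
    (hg : q + 1 = finrank ℂ E) (hδ : δ ∈ rationalForms Φ (2 * q)) :
    IsClosed (heckeImage Γ g (Quotient.mk _ '' hodgeDomainLocus Φ (stabEqs (ratCoord Φ hδ)))) := by
  obtain ⟨ψ, hψ, -, -, hD⟩ := hη.exists_divisorClass_hodgeDomainLocus_stabEqs_eq hjq hg hδ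
  rw [hD]
  exact hη.isClosed_heckeImage_image_mk_hodgeDomainLocus_stabEqs hΓ hgr hψ

/-- **Abelian varieties**: on an abelian variety of dimension `g ≥ 2`, for every arithmetic `Γ` and every curve class
`δ ∈ H^{2g-2}(X, ℚ)`, the `Γ`-translates of `D_δ` are locally finite, `Γ · D_δ` is closed and the image of `D_δ` in `Γ\D` is closed.
[cite: CattaniDeligneKaplan1995, §1 (p. 483)] [cite: MoonenOort2013Torelli, §"Hodge loci" (arXiv v1 p. 9)] [cite: Lange2023AbelianVarietiesComplex, §7.3.3 Exercise (2) (b)] -/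
theorem IsAbelianVariety.isClosed_image_mk_hodgeDomainLocus_stabEqs_of_curveClass (hX : IsAbelianVariety Φ)
    (hΓ : Γ.Commensurable (hodgeGroupInt Φ)) (hjq : j + 1 = q) (hg : q + 1 = finrank ℂ E) (hδ : δ ∈ rationalForms Φ (2 * q)) :
    LocallyFinite (fun T : MulAction.orbit Γ (hodgeDomainLocus Φ (stabEqs (ratCoord Φ hδ))) ↦ (T : Set (hodgeDomainOpens Φ))) ∧
      IsClosed (⋃ g : Γ, (g : hodgeGroup Φ) • hodgeDomainLocus Φ (stabEqs (ratCoord Φ hδ))) ∧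
      IsClosed (Quotient.mk (MulAction.orbitRel Γ (hodgeDomainOpens Φ)) '' hodgeDomainLocus Φ (stabEqs (ratCoord Φ hδ))) := by
  obtain ⟨η, hη⟩ := hX
  exact ⟨hη.locallyFinite_orbit_hodgeDomainLocus_stabEqs_of_curveClass hΓ hjq hg hδ,
    hη.isClosed_iUnion_smul_set_hodgeDomainLocus_stabEqs_of_curveClass hΓ hjq hg hδ,
    hη.isClosed_image_mk_hodgeDomainLocus_stabEqs_of_curveClass hΓ hjq hg hδ⟩

end CurveClass

/-! ## §3 Dimension three: every class of degree `4` is a curve class -/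

section DimThree

variable {η : E [⋀^Fin 2]→L[ℝ] ℝ} {Γ : Subgroup (hodgeGroup Φ)} {δ : E [⋀^Fin (2 * 2)]→L[ℝ] ℂ}

/-- **On a polarised complex torus of dimension `3`, the Noether–Lefschetz locus of every rational class of degree `4` is an
endomorphism locus** (degree `4 = 2g - 2`; together with the divisor classes this covers all Noether–Lefschetz loci of classes of
positive codimension `< g`). [cite: Lange2023AbelianVarietiesComplex, §7.3.3 Exercise (2) (b), (c) (p. 341)] [cite: MoonenOort2013Torelli, §"Special subvarieties" Example 11 / Remark 12] -/
theorem IsRiemannForm.exists_hodgeDomainLocus_stabEqs_eq_centralizerEqs_of_finrank_eq_three (hη : IsRiemannForm Φ η)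
    (h3 : finrank ℂ E = 3) (hδ : δ ∈ rationalForms Φ (2 * 2)) :
    ∃ A : Matrix ι ι ℚ, hodgeDomainLocus Φ (stabEqs (ratCoord Φ hδ)) = hodgeDomainLocus Φ (centralizerEqs A) :=
  hη.exists_hodgeDomainLocus_stabEqs_eq_centralizerEqs_of_curveClass (j := 1) rfl (by omega) hδ

/-- **On a polarised complex torus of dimension `3`, the image in `Γ\D` of the Noether–Lefschetz locus of every rational class of
degree `4` is closed** (`Γ` commensurable with `Hg(X)(ℤ)`). [cite: CattaniDeligneKaplan1995, §1 (p. 483), Thm. 1.1] [cite: Lange2023AbelianVarietiesComplex, §7.3.3 Exercise (2) (b), (c)] -/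
theorem IsRiemannForm.isClosed_image_mk_hodgeDomainLocus_stabEqs_of_finrank_eq_three (hη : IsRiemannForm Φ η)
    (hΓ : Γ.Commensurable (hodgeGroupInt Φ)) (h3 : finrank ℂ E = 3) (hδ : δ ∈ rationalForms Φ (2 * 2)) :
    IsClosed (Quotient.mk (MulAction.orbitRel Γ (hodgeDomainOpens Φ)) '' hodgeDomainLocus Φ (stabEqs (ratCoord Φ hδ))) :=
  hη.isClosed_image_mk_hodgeDomainLocus_stabEqs_of_curveClass hΓ (j := 1) rfl (by omega) hδ

end DimThree

end ComplexTorus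

end Literature.Geometry.Kaehler
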